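import Literature.NumberTheory.GaloisCohomology.Howard2004.ResidualLevelLocalPairingFlipProofs
import Literature.NumberTheory.GaloisCohomology.Howard2004.DVRSettingEngineLocalInputsProofs
import Literature.NumberTheory.GaloisCohomology.Howard2004.CasselsTateSkewPairingOfTowerPairingProofs
import Literature.NumberTheory.GaloisCohomology.Howard2004.TowerMorphismPushforward
import Literature.NumberTheory.GaloisCohomology.PoitouTate
import HarnessLib

/-!
# Howard 2004, Thm. 1.4.2 (ii) on classes: the SKEW identity of the class-level Cassels–Tate pairing as a SUM identity
# — from reciprocity at level `t+1`, the cross-level adjunctions and the level-`0` flip (proofs file, brick «C451-CL Q6c»)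

Topic `NumberTheory/GaloisCohomology/Howard2004`. THEOREMS ONLY: no definition, no named fact, no instance, no notation,
no `sorry`.  Cell `pub/bsd-print-x9` (seat `bsd-line-x10b-p1` LEAD g14, `--supports stmt-BirchSwinnertonDyer-22642`).

SETTING.  A `DVRSetting` `S` with H.0–H.5, `e₀ = 1` (bottom of a full tower, `T^{(0)} = T̄`), a level `t`, an equivariant
`ι : T^{(0)} → T^{(t+1)}` killed by `red_{t+1→0}` (on a full tower `ι = π^{t+1}·`), ONE level `p^k` of local duality for
both `T^{(0)}` and `T^{(t+1)}` with a `σ`-compatible family `inv` satisfying the reciprocity law (`SumLocalTermEqZero`),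
readings `Θ_j := (S.D j).toTateDual λ_j hλ_j exp hexp` (`j = 0, t+1`) and the local transfers
`T^j_w := H¹(Θ_j) ∘ transport_w : H¹(K_{σw}, T^{(j)}) → H¹(K_w, (T^{(j)})^D)`.

WHAT IS PROVED.  **`DVRSetting.sum_defectPairing_add_sum_defectPairing_eq_zero`** — for classes `a, b ∈ H¹(K, T^{(t)})` with
global lifts `ã, bL ∈ H¹(K, T^{(t+1)})` (`red ã = a`), LOCAL DEFECT families `m^a, m^b` (`loc_v ã - ℓ_v = ι m^a_v`,
`ℓ_v ∈ 𝓕(n)_{t+1,v}`) supported on a `σ`-stable finite set `S₀` of finite places, and global classes `W_a, W_b ∈ H¹(K, (T^{(0)})^D)`,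
`W̃_b ∈ H¹(K, (T^{(t+1)})^D)` with `loc_w W_c = T⁰_w (loc_{σw} (red^t c))`, `loc_w W̃_b = T^{t+1}_w (loc_{σw} bL)` (the dual-slot
transfers `Ψ₀ (red^t c)`, `Ψ_{t+1} bL` of the cell's `ConjugationTwistTransferProofs`, taken here through their localisations):
  `∑_{w ∈ S₀} ⟨m^a_w, loc_w W_b⟩_0 + ∑_{w ∈ S₀} ⟨m^b_w, loc_w W_a⟩_0 = 0`,
GIVEN the three local LETTERS (hypotheses here; the cell's READ-COMPAT / Q4 bricks discharge them):
(ISO) `⟨ℓ, T^{t+1}_w ℓ'⟩_{t+1} = 0` for `ℓ ∈ 𝓕(n)_{t+1,w}`, `ℓ' ∈ 𝓕(n)_{t+1,σw}` (H.4 for `𝓕(n)`);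
(ADJ-ι) `⟨ι m, T^{t+1}_w z⟩_{t+1} = ⟨m, T⁰_w (red_{t+1→0} z)⟩_0`; (ADJ-red) `⟨X, T^{t+1}_w (ι m')⟩_{t+1} = ⟨red_{t+1→0} X, T⁰_w m'⟩_0`.
PROOF (Flach / Morgan–Smith Thm. 3.7, on classes): expand the reciprocity law `∑_w ⟨ã_w, loc_w W̃_b⟩_{t+1} = 0` with
`ã_w = ι m^a_w + ℓ^a_w`, `loc_{σw} bL = ι m^b_{σw} + ℓ^b_{σw}`: `⟨ιm, Tιm'⟩ = 0` (ADJ-red, `red ∘ ι = 0`), `⟨ιm^a_w, Tℓ^b_{σw}⟩ =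
⟨m^a_w, loc_w W_b⟩_0` (ADJ-ι, `red_{t+1→0} ℓ^b = loc (red^t b)`), `⟨ℓ^a_w, T ι m^b_{σw}⟩ = ⟨loc_w (red^t a), T⁰_w m^b_{σw}⟩_0`
(ADJ-red), `⟨ℓ, Tℓ'⟩ = 0` (ISO); the second sum FLIPS to `∑_w ⟨m^b_w, loc_w W_a⟩_0`
(`sum_localTatePairingZMod_localization_transportH1_flip`, the «`G_ℚ`-invariant local Tate pairing»).  With the class-level
pairing `P a y = ∑_w ⟨m^a_w, loc_w y⟩_0` of `TowerCasselsTatePairingOfDefectsProofs` this is `P a (Ψ₀ red^t b) = - P b (Ψ₀ red^t a)`.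

HONEST FRAMING: the three letters and the transfers `W` are hypotheses here; Prop. 1.4.1, Thm. 1.4.2, C45.1′/C45.1″ and
`thm161_dvrKolyvaginBound` are NOT proved; no summit statement is proved; the Birch–Swinnerton-Dyer conjecture is not proved by
any of this.

References: [Howard2004HeegnerKolyvagin] B. Howard, Compositio Math. **140** (2004) = arXiv:1202.6340, Thm. 1.4.2 (ii) with proof
(p0008 L142 – p0009 L55), Lemma 1.5.3 (p. 10 L10–16); [MorganSmith2021CTP] Thm. 3.7 and §6.3.1, Rem. 6.3; [Flach1990] Thm. 2;
[MilneADT2006] Ch. I, Thm. 4.10 (b).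
-/

set_option autoImplicit false

noncomputable section

namespace Literature.NumberTheory.GaloisCohomology.Howard2004

open Function NumberField IsDedekindDomain Field CategoryTheory
open scoped NumberField ContRepresentation
open Literature.NumberTheory.GaloisRepresentations
open Literature.NumberTheory.GaloisRepresentations.DiscreteGaloisModule
open Literature.NumberTheory.GaloisCohomology (LocalInvariants)
open Literature.NumberTheory.EllipticCurves

namespace DVRSetting

variable {p : ℕ} [Fact p.Prime] {K : Type} [Field K] [NumberField K]
  {R : Type} [CommRing R] [IsDomain R] [IsDiscreteValuationRing R] [Algebra ℤ_[p] R]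
  {N : ℕ → Type} [∀ k, AddCommGroup (N k)] [∀ k, TopologicalSpace (N k)]
  [∀ k, DiscreteTopology (N k)] [∀ k, Module R (N k)]
  {Rk : ℕ → Type} [∀ k, CommRing (Rk k)] [∀ k, IsLocalRing (Rk k)] [∀ k, TopologicalSpace (Rk k)]
  [∀ k, DiscreteTopology (Rk k)] [∀ k, Algebra ℤ_[p] (Rk k)] [∀ k, Algebra R (Rk k)]
  [∀ k, Module (Rk k) (N k)] [∀ k, IsScalarTower R (Rk k) (N k)]
  {Nbar : Type} [AddCommGroup Nbar] [TopologicalSpace Nbar] [DiscreteTopology Nbar]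
  [∀ k, Module (Rk k) Nbar]
  {Nq : ℕ → Finset (HeightOneSpectrum (𝓞 K)) → Type} [∀ k n, AddCommGroup (Nq k n)]
  [∀ k n, TopologicalSpace (Nq k n)] [∀ k n, DiscreteTopology (Nq k n)]
  [∀ k n, Module (Rk k) (Nq k n)] [∀ k n, Module R (Nq k n)]
  [∀ k n, IsScalarTower R (Rk k) (Nq k n)]

/-! ## §1 Small letters: `red_{t+1→0} ∘ ι = 0` on local `H¹`, and `red_{t+1→0}` of a local Selmer lift -/

/-- `H¹_v(red_{t+1→0}) ∘ H¹_v(ι) = 0` when `red_{t+1→0} ∘ ι = 0` on modules (on a full tower `ι = π^{t+1}·` and `𝔪` kills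
`T^{(0)}`). [cite: Howard2004HeegnerKolyvagin, §1.6 (arXiv:1202.6340 p. 11 L33–38)] [cite: SerreGaloisCohomology1997, I §2.2] -/
theorem redLELoc_zero_cohomologyMap_eq_zero (S : DVRSetting p K R N Rk Nbar Nq) {t : ℕ} (ι : N 0 →ₗ[R] N (t + 1))
    (hιg : ∀ (g : absoluteGaloisGroup K) (x : N 0), ι (S.T.ρ 0 g x) = S.T.ρ (t + 1) g (ι x))
    (hι0 : ∀ x : N 0, S.T.redLE (Nat.zero_le (t + 1)) (ι x) = 0) (v : Place K)
    (m : galoisCohomology ((S.T.ρ 0).toLocal v) 1) :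
    S.redLELoc (Nat.zero_le (t + 1)) v
        (ContinuousRep.cohomologyMap ((S.T.ρ 0).toLocal v) ((S.T.ρ (t + 1)).toLocal v) ι.toAddMonoidHom
          continuous_of_discreteTopology (fun _ x => hιg _ x) 1 m) = 0 := by
  obtain ⟨z, rfl⟩ := oneCocycleClass_surjective _ m
  change ContinuousRep.cohomologyMap ((S.T.ρ (t + 1)).toLocal v) ((S.T.ρ 0).toLocal v)
      (S.T.redLE (Nat.zero_le (t + 1))).toAddMonoidHom continuous_of_discreteTopology
      (fun _ x => S.T.redLE_equivariant (Nat.zero_le (t + 1)) _ x) 1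
      (ContinuousRep.cohomologyMap ((S.T.ρ 0).toLocal v) ((S.T.ρ (t + 1)).toLocal v) ι.toAddMonoidHom
        continuous_of_discreteTopology (fun _ x => hιg _ x) 1 (oneCocycleClass _ z)) = 0
  rw [cohomologyMap_one_oneCocycleClass, cohomologyMap_one_oneCocycleClass]
  refine (oneCocycleClass_eq_zero_iff _ _).2 ⟨0, fun g ↦ ?_⟩
  rw [map_zero, sub_zero]
  exact hι0 (z.1 g)

/-! ## §2 The skew identity as a sum identity -/

section Skew

variable (S : DVRSetting p K R N Rk Nbar Nq) (hy : S.SatisfiesH) {k : ℕ}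
  (lam₀ : Rk 0 →+ ZMod (p ^ k))
  (hlam₀ : ∀ (z : ℤ_[p]) (r : Rk 0), lam₀ (algebraMap ℤ_[p] (Rk 0) z * r) = PadicInt.toZModPow k z * lam₀ r)
  {t : ℕ} (lam₁ : Rk (t + 1) →+ ZMod (p ^ k))
  (hlam₁ : ∀ (z : ℤ_[p]) (r : Rk (t + 1)), lam₁ (algebraMap ℤ_[p] (Rk (t + 1)) z * r) = PadicInt.toZModPow k z * lam₁ r)
  (exp : ZMod (p ^ k) →+ MuCarrier K (p ^ k))
  (hexp : ∀ (g : absoluteGaloisGroup K) (x : ZMod (p ^ k)),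
    exp (cyclotomicCharacterModPow K p k g * x) = mu K (p ^ k) g (exp x))

set_option maxHeartbeats 400000 in
include hy hlam₀ hlam₁ hexp in
/-- **THE SKEW IDENTITY AS A SUM IDENTITY** (Howard Thm. 1.4.2 (ii) «`(a, π^{s-1}b)_{s,1} = -(b, π^{s-1}a)_{s,1}`», on classes;
see the module docstring for the setting, the letters (ISO), (ADJ-ι), (ADJ-red) and the proof).
[cite: Howard2004HeegnerKolyvagin, Thm. 1.4.2 (ii) with proof and Lemma 1.5.3 (arXiv:1202.6340 p0008 L142 – p0009 L55; p. 10 L10–16)]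
[cite: MorganSmith2021CTP, Thm. 3.7 and §6.3.1] [cite: MilneADT2006, Ch. I, Thm. 4.10 (b)] -/
theorem sum_defectPairing_add_sum_defectPairing_eq_zero [NeZero (p ^ k)] [Finite (N 0)] [Finite (N (t + 1))]
    (he : S.e 0 = 1) (n : Finset (HeightOneSpectrum (𝓞 K)))
    (ι : N 0 →ₗ[R] N (t + 1))
    (hιg : ∀ (g : absoluteGaloisGroup K) (x : N 0), ι (S.T.ρ 0 g x) = S.T.ρ (t + 1) g (ι x))
    (hι0 : ∀ x : N 0, S.T.redLE (Nat.zero_le (t + 1)) (ι x) = 0)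
    (hM : ∀ x : N (t + 1), (p ^ k) • x = 0)
    (inv : LocalInvariants K (p ^ k)) (hinv : inv.IsConjCompatible S.cd.σ) (hPT : inv.SumLocalTermEqZero)
    -- the three local letters
    (hISO : ∀ (w : HeightOneSpectrum (𝓞 K)) (ℓ : galoisCohomology ((S.T.ρ (t + 1)).toLocal (Sum.inr w)) 1)
      (_ : ℓ ∈ ((S.t (t + 1)).atLevel S.jbar n).cond (Sum.inr w))
      (ℓ' : galoisCohomology ((S.T.ρ (t + 1)).toLocal (Sum.inr (S.cd.σ • w))) 1)
      (_ : ℓ' ∈ ((S.t (t + 1)).atLevel S.jbar n).cond (Sum.inr (S.cd.σ • w))),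
      localTatePairingZMod (S.T.ρ (t + 1)) (p ^ k) (Sum.inr w) (inv (Sum.inr w)) ℓ
        (galoisCohomology.map (DiscreteGaloisModule.localMap ((S.D (t + 1)).toTateDual lam₁ hlam₁ exp hexp)
          (Sum.inr w)) 1 (S.cd.transportH1 (S.T.ρ (t + 1)) w ℓ')) = 0)
    (hADJι : ∀ (w : HeightOneSpectrum (𝓞 K)) (m : galoisCohomology ((S.T.ρ 0).toLocal (Sum.inr w)) 1)
      (z : galoisCohomology ((S.T.ρ (t + 1)).toLocal (Sum.inr (S.cd.σ • w))) 1),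
      localTatePairingZMod (S.T.ρ (t + 1)) (p ^ k) (Sum.inr w) (inv (Sum.inr w))
        (ContinuousRep.cohomologyMap ((S.T.ρ 0).toLocal (Sum.inr w)) ((S.T.ρ (t + 1)).toLocal (Sum.inr w))
          ι.toAddMonoidHom continuous_of_discreteTopology (fun _ x => hιg _ x) 1 m)
        (galoisCohomology.map (DiscreteGaloisModule.localMap ((S.D (t + 1)).toTateDual lam₁ hlam₁ exp hexp)
          (Sum.inr w)) 1 (S.cd.transportH1 (S.T.ρ (t + 1)) w z)) =
      localTatePairingZMod (S.T.ρ 0) (p ^ k) (Sum.inr w) (inv (Sum.inr w)) m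
        (galoisCohomology.map (DiscreteGaloisModule.localMap ((S.D 0).toTateDual lam₀ hlam₀ exp hexp) (Sum.inr w)) 1
          (S.cd.transportH1 (S.T.ρ 0) w (S.redLELoc (Nat.zero_le (t + 1)) (Sum.inr (S.cd.σ • w)) z))))
    (hADJred : ∀ (w : HeightOneSpectrum (𝓞 K)) (X : galoisCohomology ((S.T.ρ (t + 1)).toLocal (Sum.inr w)) 1)
      (m' : galoisCohomology ((S.T.ρ 0).toLocal (Sum.inr (S.cd.σ • w))) 1),
      localTatePairingZMod (S.T.ρ (t + 1)) (p ^ k) (Sum.inr w) (inv (Sum.inr w)) X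
        (galoisCohomology.map (DiscreteGaloisModule.localMap ((S.D (t + 1)).toTateDual lam₁ hlam₁ exp hexp)
          (Sum.inr w)) 1 (S.cd.transportH1 (S.T.ρ (t + 1)) w
            (ContinuousRep.cohomologyMap ((S.T.ρ 0).toLocal (Sum.inr (S.cd.σ • w)))
              ((S.T.ρ (t + 1)).toLocal (Sum.inr (S.cd.σ • w))) ι.toAddMonoidHom continuous_of_discreteTopology
              (fun _ x => hιg _ x) 1 m'))) =
      localTatePairingZMod (S.T.ρ 0) (p ^ k) (Sum.inr w) (inv (Sum.inr w))
        (S.redLELoc (Nat.zero_le (t + 1)) (Sum.inr w) X)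
        (galoisCohomology.map (DiscreteGaloisModule.localMap ((S.D 0).toTateDual lam₀ hlam₀ exp hexp) (Sum.inr w)) 1
          (S.cd.transportH1 (S.T.ρ 0) w m')))
    -- the classes, their lifts and local defects
    (a b : galoisCohomology (S.T.ρ t) 1) (aL bL : galoisCohomology (S.T.ρ (t + 1)) 1)
    (haL : S.redLEH1 (Nat.le_succ t) aL = a) (hbL : S.redLEH1 (Nat.le_succ t) bL = b)
    (ma mb : ∀ v : Place K, galoisCohomology ((S.T.ρ 0).toLocal v) 1)
    (hma : ∀ v, ∃ ℓ ∈ ((S.t (t + 1)).atLevel S.jbar n).cond v,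
      galoisCohomology.localization (S.T.ρ (t + 1)) v 1 aL - ℓ =
        ContinuousRep.cohomologyMap ((S.T.ρ 0).toLocal v) ((S.T.ρ (t + 1)).toLocal v) ι.toAddMonoidHom
          continuous_of_discreteTopology (fun _ x => hιg _ x) 1 (ma v))
    (hmb : ∀ v, ∃ ℓ ∈ ((S.t (t + 1)).atLevel S.jbar n).cond v,
      galoisCohomology.localization (S.T.ρ (t + 1)) v 1 bL - ℓ =
        ContinuousRep.cohomologyMap ((S.T.ρ 0).toLocal v) ((S.T.ρ (t + 1)).toLocal v) ι.toAddMonoidHom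
          continuous_of_discreteTopology (fun _ x => hιg _ x) 1 (mb v))
    (S₀ : Finset (HeightOneSpectrum (𝓞 K))) (hS₀ : ∀ v ∈ S₀, S.cd.σ • v ∈ S₀)
    (hmaS : ∀ w : HeightOneSpectrum (𝓞 K), w ∉ S₀ → ma (Sum.inr w) = 0)
    (hmbS : ∀ w : HeightOneSpectrum (𝓞 K), w ∉ S₀ → mb (Sum.inr w) = 0)
    -- the dual-slot transfers, through their localisations
    (Wa Wb : galoisCohomology ((S.T.ρ 0).tateDual (p ^ k)) 1)
    (hWa : ∀ w : HeightOneSpectrum (𝓞 K), galoisCohomology.localization ((S.T.ρ 0).tateDual (p ^ k)) (Sum.inr w) 1 Wa =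
      galoisCohomology.map (DiscreteGaloisModule.localMap ((S.D 0).toTateDual lam₀ hlam₀ exp hexp) (Sum.inr w)) 1
        (S.cd.transportH1 (S.T.ρ 0) w
          (galoisCohomology.localization (S.T.ρ 0) (Sum.inr (S.cd.σ • w)) 1 (S.redLEH1 (Nat.zero_le t) a))))
    (hWb : ∀ w : HeightOneSpectrum (𝓞 K), galoisCohomology.localization ((S.T.ρ 0).tateDual (p ^ k)) (Sum.inr w) 1 Wb =
      galoisCohomology.map (DiscreteGaloisModule.localMap ((S.D 0).toTateDual lam₀ hlam₀ exp hexp) (Sum.inr w)) 1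
        (S.cd.transportH1 (S.T.ρ 0) w
          (galoisCohomology.localization (S.T.ρ 0) (Sum.inr (S.cd.σ • w)) 1 (S.redLEH1 (Nat.zero_le t) b))))
    (Wb' : galoisCohomology ((S.T.ρ (t + 1)).tateDual (p ^ k)) 1)
    (hWb' : ∀ w : HeightOneSpectrum (𝓞 K),
      galoisCohomology.localization ((S.T.ρ (t + 1)).tateDual (p ^ k)) (Sum.inr w) 1 Wb' =
        galoisCohomology.map (DiscreteGaloisModule.localMap ((S.D (t + 1)).toTateDual lam₁ hlam₁ exp hexp)
          (Sum.inr w)) 1 (S.cd.transportH1 (S.T.ρ (t + 1)) w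
            (galoisCohomology.localization (S.T.ρ (t + 1)) (Sum.inr (S.cd.σ • w)) 1 bL))) :
    ∑ w ∈ S₀, localTatePairingZMod (S.T.ρ 0) (p ^ k) (Sum.inr w) (inv (Sum.inr w)) (ma (Sum.inr w))
        (galoisCohomology.localization ((S.T.ρ 0).tateDual (p ^ k)) (Sum.inr w) 1 Wb) +
      ∑ w ∈ S₀, localTatePairingZMod (S.T.ρ 0) (p ^ k) (Sum.inr w) (inv (Sum.inr w)) (mb (Sum.inr w))
        (galoisCohomology.localization ((S.T.ρ 0).tateDual (p ^ k)) (Sum.inr w) 1 Wa) = 0 := by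
  classical
  have hσσ : ∀ v : HeightOneSpectrum (𝓞 K), S.cd.σ • (S.cd.σ • v) = v := fun v ↦ by
    rw [smul_smul, S.cd.sigma_mul_sigma_eq_one, one_smul]
  -- `red_{t+1→0}` of a local Selmer lift `ℓ` of `c'` (`loc c' - ℓ = ι m`) is the localisation of `red^t c`
  have hred : ∀ (c : galoisCohomology (S.T.ρ t) 1) (c' : galoisCohomology (S.T.ρ (t + 1)) 1)
      (_ : S.redLEH1 (Nat.le_succ t) c' = c) (v : Place K) (mm : galoisCohomology ((S.T.ρ 0).toLocal v) 1)
      (ℓ : galoisCohomology ((S.T.ρ (t + 1)).toLocal v) 1)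
      (_ : (galoisCohomology.localization (S.T.ρ (t + 1)) v 1 c') - ℓ =
        (ContinuousRep.cohomologyMap ((S.T.ρ 0).toLocal v) ((S.T.ρ (t + 1)).toLocal v) ι.toAddMonoidHom
          continuous_of_discreteTopology (fun _ x => hιg _ x) 1 mm)),
      S.redLELoc (Nat.zero_le (t + 1)) v ℓ =
        galoisCohomology.localization (S.T.ρ 0) v 1 (S.redLEH1 (Nat.zero_le t) c) := by
    intro c c' hc v mm ℓ heq
    have h1 := congrArg (S.redLELoc (Nat.zero_le (t + 1)) v) heq
    rw [map_sub, S.redLELoc_zero_cohomologyMap_eq_zero ι hιg hι0 v mm, sub_eq_zero] at h1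
    rw [← h1, ← S.localization_redLEH1 (Nat.zero_le (t + 1)) v c', ← hc]
    congr 1
    rw [S.redLEH1_succ (Nat.zero_le t) c', S.redLEH1_succ (le_refl t) c', S.redLEH1_self]
  -- RECIPROCITY at level `t+1` for the global pair `(ã, W̃_b)`, summed over `S₀`
  have hzero_off : ∀ v ∉ S₀.map ⟨Sum.inr, Sum.inr_injective⟩, inv.localTerm (S.T.ρ (t + 1)) v aL Wb' = 0 := by
    intro v hv
    rcases v with w | w
    · -- infinite place: `H¹(K_w, T^{(t+1)}) = 0`
      rw [LocalInvariants.localTerm_apply, S.localization_inl_eq_zero_level hy (t + 1) w aL, map_zero,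
        AddMonoidHom.zero_apply, map_zero]
    · have hw : w ∉ S₀ := fun h ↦ hv (Finset.mem_map.2 ⟨w, h, rfl⟩)
      have hσw : S.cd.σ • w ∉ S₀ := fun h ↦ hw (by simpa only [hσσ] using hS₀ _ h)
      obtain ⟨ℓa, hℓa, heqa⟩ := hma (Sum.inr w)
      obtain ⟨ℓb, hℓb, heqb⟩ := hmb (Sum.inr (S.cd.σ • w))
      have ha0 : (galoisCohomology.localization (S.T.ρ (t + 1)) (Sum.inr w) 1 aL) = ℓa := by
        rw [← sub_eq_zero, heqa, hmaS w hw]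
        exact map_zero _
      have hb0 : (galoisCohomology.localization (S.T.ρ (t + 1)) (Sum.inr (S.cd.σ • w)) 1 bL) = ℓb := by
        rw [← sub_eq_zero, heqb, hmbS _ hσw]
        exact map_zero _
      rw [LocalInvariants.localTerm_apply, ← localTatePairingZMod_apply, hWb' w, ha0, hb0]
      exact hISO w ℓa hℓa ℓb hℓb
  have hrecip : ∑ w ∈ S₀, inv.localTerm (S.T.ρ (t + 1)) (Sum.inr w) aL Wb' = 0 := by
    have h := hPT (S.T.ρ (t + 1)) hM aL Wb' (S₀.map ⟨Sum.inr, Sum.inr_injective⟩) hzero_off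
    rw [Finset.sum_map] at h
    exact h
  -- expand each term
  have hterm : ∀ w ∈ S₀, inv.localTerm (S.T.ρ (t + 1)) (Sum.inr w) aL Wb' =
      localTatePairingZMod (S.T.ρ 0) (p ^ k) (Sum.inr w) (inv (Sum.inr w))
        (ma (Sum.inr w))
        (galoisCohomology.localization ((S.T.ρ 0).tateDual (p ^ k)) (Sum.inr w) 1 Wb) +
        localTatePairingZMod (S.T.ρ 0) (p ^ k) (Sum.inr w) (inv (Sum.inr w))
        (galoisCohomology.localization (S.T.ρ 0) (Sum.inr w) 1 (S.redLEH1 (Nat.zero_le t) a))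
        (galoisCohomology.map (DiscreteGaloisModule.localMap ((S.D 0).toTateDual lam₀ hlam₀ exp hexp) (Sum.inr w)) 1
          (S.cd.transportH1 (S.T.ρ 0) w (mb (Sum.inr (S.cd.σ • w))))) := by
    intro w _
    obtain ⟨ℓa, hℓa, heqa⟩ := hma (Sum.inr w)
    obtain ⟨ℓb, hℓb, heqb⟩ := hmb (Sum.inr (S.cd.σ • w))
    -- `T¹(loc b̃) = T¹(ι m^b) + T¹(ℓ^b)` and `⟨loc ã, Y⟩ = ⟨ι m^a, Y⟩ + ⟨ℓ^a, Y⟩`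
    have eB : (galoisCohomology.map (DiscreteGaloisModule.localMap ((S.D (t + 1)).toTateDual lam₁ hlam₁ exp hexp)
          (Sum.inr w)) 1 (S.cd.transportH1 (S.T.ρ (t + 1)) w (galoisCohomology.localization (S.T.ρ (t + 1)) (Sum.inr (S.cd.σ • w)) 1 bL))) =
        (galoisCohomology.map (DiscreteGaloisModule.localMap ((S.D (t + 1)).toTateDual lam₁ hlam₁ exp hexp)
          (Sum.inr w)) 1 (S.cd.transportH1 (S.T.ρ (t + 1)) w (ContinuousRep.cohomologyMap ((S.T.ρ 0).toLocal (Sum.inr (S.cd.σ • w))) ((S.T.ρ (t + 1)).toLocal (Sum.inr (S.cd.σ • w))) ι.toAddMonoidHom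
          continuous_of_discreteTopology (fun _ x => hιg _ x) 1 (mb (Sum.inr (S.cd.σ • w)))))) +
        (galoisCohomology.map (DiscreteGaloisModule.localMap ((S.D (t + 1)).toTateDual lam₁ hlam₁ exp hexp)
          (Sum.inr w)) 1 (S.cd.transportH1 (S.T.ρ (t + 1)) w ℓb)) := by
      have h := congrArg ((galoisCohomology.map (DiscreteGaloisModule.localMap
        ((S.D (t + 1)).toTateDual lam₁ hlam₁ exp hexp) (Sum.inr w)) 1).comp (S.cd.transportH1 (S.T.ρ (t + 1)) w)) heqb
      rw [map_sub, sub_eq_iff_eq_add] at h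
      exact h
    have eA : ∀ Y, localTatePairingZMod (S.T.ρ (t + 1)) (p ^ k) (Sum.inr w) (inv (Sum.inr w))
        (galoisCohomology.localization (S.T.ρ (t + 1)) (Sum.inr w) 1 aL)
        Y =
        localTatePairingZMod (S.T.ρ (t + 1)) (p ^ k) (Sum.inr w) (inv (Sum.inr w))
        (ContinuousRep.cohomologyMap ((S.T.ρ 0).toLocal (Sum.inr w)) ((S.T.ρ (t + 1)).toLocal (Sum.inr w)) ι.toAddMonoidHom
          continuous_of_discreteTopology (fun _ x => hιg _ x) 1 (ma (Sum.inr w)))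
        Y +
        localTatePairingZMod (S.T.ρ (t + 1)) (p ^ k) (Sum.inr w) (inv (Sum.inr w))
        ℓa
        Y := by
      intro Y
      have h := congrArg ((localTatePairingZMod (S.T.ρ (t + 1)) (p ^ k) (Sum.inr w) (inv (Sum.inr w))).flip Y) heqa
      rw [map_sub, sub_eq_iff_eq_add] at h
      exact h
    -- the four terms
    have h1 : localTatePairingZMod (S.T.ρ (t + 1)) (p ^ k) (Sum.inr w) (inv (Sum.inr w))
        (ContinuousRep.cohomologyMap ((S.T.ρ 0).toLocal (Sum.inr w)) ((S.T.ρ (t + 1)).toLocal (Sum.inr w)) ι.toAddMonoidHom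
          continuous_of_discreteTopology (fun _ x => hιg _ x) 1 (ma (Sum.inr w)))
        (galoisCohomology.map (DiscreteGaloisModule.localMap ((S.D (t + 1)).toTateDual lam₁ hlam₁ exp hexp)
          (Sum.inr w)) 1 (S.cd.transportH1 (S.T.ρ (t + 1)) w (ContinuousRep.cohomologyMap ((S.T.ρ 0).toLocal (Sum.inr (S.cd.σ • w))) ((S.T.ρ (t + 1)).toLocal (Sum.inr (S.cd.σ • w))) ι.toAddMonoidHom
          continuous_of_discreteTopology (fun _ x => hιg _ x) 1 (mb (Sum.inr (S.cd.σ • w)))))) = 0 := by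
      rw [hADJred w, S.redLELoc_zero_cohomologyMap_eq_zero ι hιg hι0, map_zero, AddMonoidHom.zero_apply]
    have h2 : localTatePairingZMod (S.T.ρ (t + 1)) (p ^ k) (Sum.inr w) (inv (Sum.inr w))
        (ContinuousRep.cohomologyMap ((S.T.ρ 0).toLocal (Sum.inr w)) ((S.T.ρ (t + 1)).toLocal (Sum.inr w)) ι.toAddMonoidHom
          continuous_of_discreteTopology (fun _ x => hιg _ x) 1 (ma (Sum.inr w)))
        (galoisCohomology.map (DiscreteGaloisModule.localMap ((S.D (t + 1)).toTateDual lam₁ hlam₁ exp hexp)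
          (Sum.inr w)) 1 (S.cd.transportH1 (S.T.ρ (t + 1)) w ℓb)) =
        localTatePairingZMod (S.T.ρ 0) (p ^ k) (Sum.inr w) (inv (Sum.inr w))
        (ma (Sum.inr w))
        (galoisCohomology.localization ((S.T.ρ 0).tateDual (p ^ k)) (Sum.inr w) 1 Wb) := by
      rw [hADJι w, hred b bL hbL _ _ ℓb heqb, ← hWb w]
    have h3 : localTatePairingZMod (S.T.ρ (t + 1)) (p ^ k) (Sum.inr w) (inv (Sum.inr w))
        ℓa
        (galoisCohomology.map (DiscreteGaloisModule.localMap ((S.D (t + 1)).toTateDual lam₁ hlam₁ exp hexp)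
          (Sum.inr w)) 1 (S.cd.transportH1 (S.T.ρ (t + 1)) w (ContinuousRep.cohomologyMap ((S.T.ρ 0).toLocal (Sum.inr (S.cd.σ • w))) ((S.T.ρ (t + 1)).toLocal (Sum.inr (S.cd.σ • w))) ι.toAddMonoidHom
          continuous_of_discreteTopology (fun _ x => hιg _ x) 1 (mb (Sum.inr (S.cd.σ • w)))))) =
        localTatePairingZMod (S.T.ρ 0) (p ^ k) (Sum.inr w) (inv (Sum.inr w))
        (galoisCohomology.localization (S.T.ρ 0) (Sum.inr w) 1 (S.redLEH1 (Nat.zero_le t) a))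
        (galoisCohomology.map (DiscreteGaloisModule.localMap ((S.D 0).toTateDual lam₀ hlam₀ exp hexp) (Sum.inr w)) 1
          (S.cd.transportH1 (S.T.ρ 0) w (mb (Sum.inr (S.cd.σ • w))))) := by
      rw [hADJred w, hred a aL haL _ _ ℓa heqa]
    have h4 : localTatePairingZMod (S.T.ρ (t + 1)) (p ^ k) (Sum.inr w) (inv (Sum.inr w))
        ℓa
        (galoisCohomology.map (DiscreteGaloisModule.localMap ((S.D (t + 1)).toTateDual lam₁ hlam₁ exp hexp)
          (Sum.inr w)) 1 (S.cd.transportH1 (S.T.ρ (t + 1)) w ℓb)) = 0 :=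
      hISO w ℓa hℓa ℓb hℓb
    rw [LocalInvariants.localTerm_apply, ← localTatePairingZMod_apply]
    rw [hWb' w]
    rw [eA]
    rw [eB]
    simp only [map_add, h1, h2, h3, h4, zero_add, add_zero]
  rw [Finset.sum_congr rfl hterm, Finset.sum_add_distrib] at hrecip
  -- FLIP the second sum
  have hflip := S.sum_localTatePairingZMod_localization_transportH1_flip hy lam₀ hlam₀ exp hexp he inv hinv
    (S.redLEH1 (Nat.zero_le t) a) (fun w ↦ mb (Sum.inr w)) S₀ hS₀
  have hflip' : ∑ w ∈ S₀, localTatePairingZMod (S.T.ρ 0) (p ^ k) (Sum.inr w) (inv (Sum.inr w))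
        (galoisCohomology.localization (S.T.ρ 0) (Sum.inr w) 1 (S.redLEH1 (Nat.zero_le t) a))
        (galoisCohomology.map (DiscreteGaloisModule.localMap ((S.D 0).toTateDual lam₀ hlam₀ exp hexp) (Sum.inr w)) 1
          (S.cd.transportH1 (S.T.ρ 0) w (mb (Sum.inr (S.cd.σ • w))))) =
      ∑ w ∈ S₀, localTatePairingZMod (S.T.ρ 0) (p ^ k) (Sum.inr w) (inv (Sum.inr w))
        (mb (Sum.inr w))
        (galoisCohomology.localization ((S.T.ρ 0).tateDual (p ^ k)) (Sum.inr w) 1 Wa) := by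
    rw [hflip]
    exact Finset.sum_congr rfl fun w _ ↦ by rw [hWa w]
  rw [hflip'] at hrecip
  exact hrecip

end Skew

end DVRSetting

end Literature.NumberTheory.GaloisCohomology.Howard2004

end
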